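import Mathlib
import Summits.AtomisticToContinuum.FouriersLaw.Theorems.EmbeddedDrudeMourreDrudeDissolutionResonanceStructure
import Summits.AtomisticToContinuum.FouriersLaw.Theorems.EmbeddedDrudeMourreDrudeDissolutionStubExcursionSecondDifferenceConcreteRegularity
import HarnessLib

/-!
# Structure bounds for the second and third derivatives of the pair resonance
(crux `EmbeddedDrudeMourre.DrudeDissolution`, item stmt-AtomisticToContinuum-12593; `--supports` file for the
registered sub-goal `resonance_structure_bounds` of stub B1b″ `stub_excursionSecondDifference` of line
`kinetic-polymer-gas-on-the-time-axis`; closes nothing; lead c13 (process B), 2026-08-17)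

WHAT. For `Ω = −A·S₁·S₂` read at `p = (k₁,(k₃,k₂))` (`resonance_product_structure`) and any frame of
"admissible" directions `e i` (coordinates and the two half-differences bounded by `1`, e.g. the standard
basis), with `d k = ∂_{e k}Ω`:
* `resonance_structure_bounds` (registered): there are `Cₙ, C_t ≥ 0` with, at every `p` and all `k j l`,
  `|∂_{e j} d_k (p)| ≤ Cₙ·(|A p| + |S₁ p| + |S₂ p|)` (the Hessian of `Ω` vanishes to first order on the critical
  curves) and `|∂_{e l}∂_{e j} d_k (p)| ≤ C_t`.
The first is the product rule applied to `d_k = −(a_k S₁S₂ + A s₁ₖ S₂ + A S₁ s₂ₖ)` (`a_k = ∂_{e k}A`,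
`sᵢₖ = ∂_{e k}Sᵢ`; abstract form `structure_fderiv_d_bound`), with the uniform bounds `resonance_A_bounds`; the
second is continuity + `2π`-periodicity (`exists_bound_of_periodic3`).

WHY (role). The inputs `n ≤ Cₙ(x+y+z)` and `t ≤ C_t` of `flux_pointwise_bound` in the sup-norm route (item
(C2-Ω)/(C6) of the remaining concrete work for B1b″).
-/

noncomputable section

open scoped Topology
open Filter Set

namespace Summit.AtomisticToContinuum.FouriersLaw.Theorems.DrudeDissolution.KineticPolymerGasOnTheTimeAxis

open Literature.MathematicalPhysics.KineticTheory
open Literature.MathematicalPhysics.KineticTheory.PhononBoltzmann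

/-! ### Abstract product-rule bound -/

/-- Triple product rule along a direction. [folklore] -/
theorem fp_mul3 {V : Type*} [NormedAddCommGroup V] [NormedSpace ℝ V] {u v w : V → ℝ} {p : V}
    (hu : DifferentiableAt ℝ u p) (hv : DifferentiableAt ℝ v p) (hw : DifferentiableAt ℝ w p) (e : V) :
    fderiv ℝ (fun q => u q * v q * w q) p e =
      fderiv ℝ u p e * v p * w p + u p * fderiv ℝ v p e * w p + u p * v p * fderiv ℝ w p e := by
  have huv : DifferentiableAt ℝ (fun q => u q * v q) p := hu.mul hv
  rw [fp_mul huv hw, fp_mul hu hv]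
  ring

/-- **Abstract structure bound.** If `d = −(a S₁ S₂ + A s₁ S₂ + A S₁ s₂)` with all six factors differentiable
at `p`, `|S₁|,|S₂|,|s₁|,|s₂| ≤ 1` at `p`, their derivatives along `v` bounded by `1`, and `|a|, |∂ᵥa|, |∂ᵥA| ≤ K`
(`K ≥ 1`), then `|∂ᵥ d (p)| ≤ 9K(|A p| + |S₁ p| + |S₂ p|)`. [folklore] -/
theorem structure_fderiv_d_bound {V : Type*} [NormedAddCommGroup V] [NormedSpace ℝ V]
    {A S₁ S₂ a s₁ s₂ d : V → ℝ} {p v : V} {K : ℝ} (hK : 1 ≤ K)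
    (hAd : DifferentiableAt ℝ A p) (hS₁d : DifferentiableAt ℝ S₁ p) (hS₂d : DifferentiableAt ℝ S₂ p)
    (had : DifferentiableAt ℝ a p) (hs₁d : DifferentiableAt ℝ s₁ p) (hs₂d : DifferentiableAt ℝ s₂ p)
    (hd : d = fun q => -(a q * S₁ q * S₂ q + A q * s₁ q * S₂ q + A q * S₁ q * s₂ q))
    (bS₁ : |S₁ p| ≤ 1) (bS₂ : |S₂ p| ≤ 1) (bs₁ : |s₁ p| ≤ 1) (bs₂ : |s₂ p| ≤ 1)
    (bS₁' : |fderiv ℝ S₁ p v| ≤ 1) (bS₂' : |fderiv ℝ S₂ p v| ≤ 1) (bs₁' : |fderiv ℝ s₁ p v| ≤ 1)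
    (bs₂' : |fderiv ℝ s₂ p v| ≤ 1) (ba : |a p| ≤ K) (ba' : |fderiv ℝ a p v| ≤ K) (bA' : |fderiv ℝ A p v| ≤ K) :
    |fderiv ℝ d p v| ≤ 9 * K * (|A p| + |S₁ p| + |S₂ p|) := by
  have hK0 : 0 ≤ K := by linarith
  have h1 : DifferentiableAt ℝ (fun q => a q * S₁ q * S₂ q) p := (had.mul hS₁d).mul hS₂d
  have h2 : DifferentiableAt ℝ (fun q => A q * s₁ q * S₂ q) p := (hAd.mul hs₁d).mul hS₂d
  have h3 : DifferentiableAt ℝ (fun q => A q * S₁ q * s₂ q) p := (hAd.mul hS₁d).mul hs₂d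
  have h12 : DifferentiableAt ℝ (fun q => a q * S₁ q * S₂ q + A q * s₁ q * S₂ q) p := h1.add h2
  have hcalc : fderiv ℝ d p v =
      -((fderiv ℝ a p v * S₁ p * S₂ p + a p * fderiv ℝ S₁ p v * S₂ p + a p * S₁ p * fderiv ℝ S₂ p v) +
        (fderiv ℝ A p v * s₁ p * S₂ p + A p * fderiv ℝ s₁ p v * S₂ p + A p * s₁ p * fderiv ℝ S₂ p v) +
        (fderiv ℝ A p v * S₁ p * s₂ p + A p * fderiv ℝ S₁ p v * s₂ p + A p * S₁ p * fderiv ℝ s₂ p v)) := by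
    rw [hd, fderiv_fun_neg, neg_apply, fderiv_fun_add h12 h3, fderiv_fun_add h1 h2]
    simp only [add_apply]
    rw [fp_mul3 had hS₁d hS₂d, fp_mul3 hAd hs₁d hS₂d, fp_mul3 hAd hS₁d hs₂d]
  rw [hcalc, abs_neg]
  have nA := abs_nonneg (A p)
  have n1 := abs_nonneg (S₁ p)
  have n2 := abs_nonneg (S₂ p)
  -- the nine terms
  have t1 : |fderiv ℝ a p v * S₁ p * S₂ p| ≤ K * |S₂ p| := by
    rw [abs_mul, abs_mul]
    calc |fderiv ℝ a p v| * |S₁ p| * |S₂ p| ≤ K * 1 * |S₂ p| := by gcongr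
      _ = K * |S₂ p| := by ring
  have t2 : |a p * fderiv ℝ S₁ p v * S₂ p| ≤ K * |S₂ p| := by
    rw [abs_mul, abs_mul]
    calc |a p| * |fderiv ℝ S₁ p v| * |S₂ p| ≤ K * 1 * |S₂ p| := by gcongr
      _ = K * |S₂ p| := by ring
  have t3 : |a p * S₁ p * fderiv ℝ S₂ p v| ≤ K * |S₁ p| := by
    rw [abs_mul, abs_mul]
    calc |a p| * |S₁ p| * |fderiv ℝ S₂ p v| ≤ K * |S₁ p| * 1 := by gcongr
      _ = K * |S₁ p| := by ring
  have t4 : |fderiv ℝ A p v * s₁ p * S₂ p| ≤ K * |S₂ p| := by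
    rw [abs_mul, abs_mul]
    calc |fderiv ℝ A p v| * |s₁ p| * |S₂ p| ≤ K * 1 * |S₂ p| := by gcongr
      _ = K * |S₂ p| := by ring
  have t5 : |A p * fderiv ℝ s₁ p v * S₂ p| ≤ K * |A p| := by
    rw [abs_mul, abs_mul]
    calc |A p| * |fderiv ℝ s₁ p v| * |S₂ p| ≤ |A p| * 1 * 1 := by gcongr
      _ ≤ K * |A p| := by nlinarith
  have t6 : |A p * s₁ p * fderiv ℝ S₂ p v| ≤ K * |A p| := by
    rw [abs_mul, abs_mul]
    calc |A p| * |s₁ p| * |fderiv ℝ S₂ p v| ≤ |A p| * 1 * 1 := by gcongr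
      _ ≤ K * |A p| := by nlinarith
  have t7 : |fderiv ℝ A p v * S₁ p * s₂ p| ≤ K * |S₁ p| := by
    rw [abs_mul, abs_mul]
    calc |fderiv ℝ A p v| * |S₁ p| * |s₂ p| ≤ K * |S₁ p| * 1 := by gcongr
      _ = K * |S₁ p| := by ring
  have t8 : |A p * fderiv ℝ S₁ p v * s₂ p| ≤ K * |A p| := by
    rw [abs_mul, abs_mul]
    calc |A p| * |fderiv ℝ S₁ p v| * |s₂ p| ≤ |A p| * 1 * 1 := by gcongr
      _ ≤ K * |A p| := by nlinarith
  have t9 : |A p * S₁ p * fderiv ℝ s₂ p v| ≤ K * |A p| := by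
    rw [abs_mul, abs_mul]
    calc |A p| * |S₁ p| * |fderiv ℝ s₂ p v| ≤ |A p| * 1 * 1 := by gcongr
      _ ≤ K * |A p| := by nlinarith
  have tri : ∀ x y z : ℝ, |x + y + z| ≤ |x| + |y| + |z| := fun x y z =>
    (abs_add_le _ _).trans (by linarith [abs_add_le x y])
  calc |(fderiv ℝ a p v * S₁ p * S₂ p + a p * fderiv ℝ S₁ p v * S₂ p + a p * S₁ p * fderiv ℝ S₂ p v) +
        (fderiv ℝ A p v * s₁ p * S₂ p + A p * fderiv ℝ s₁ p v * S₂ p + A p * s₁ p * fderiv ℝ S₂ p v) +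
        (fderiv ℝ A p v * S₁ p * s₂ p + A p * fderiv ℝ S₁ p v * s₂ p + A p * S₁ p * fderiv ℝ s₂ p v)|
      ≤ (K * |S₂ p| + K * |S₂ p| + K * |S₁ p|) + (K * |S₂ p| + K * |A p| + K * |A p|) +
          (K * |S₁ p| + K * |A p| + K * |A p|) := by
        refine (tri _ _ _).trans (add_le_add (add_le_add ?_ ?_) ?_)
        · exact (tri _ _ _).trans (add_le_add (add_le_add t1 t2) t3)
        · exact (tri _ _ _).trans (add_le_add (add_le_add t4 t5) t6)
        · exact (tri _ _ _).trans (add_le_add (add_le_add t7 t8) t9)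
    _ ≤ 9 * K * (|A p| + |S₁ p| + |S₂ p|) := by nlinarith

/-! ### The half-angle sines along admissible directions -/

/-- For `S(p) = sin(L p/2)` (`L` linear) and directions `u, v` with `|L u|, |L v| ≤ 1`: `S` and `s = ∂ᵤS` are
differentiable with `|S|, |∂ᵥS|, |s|, |∂ᵥ s| ≤ 1`. [folklore] -/
theorem halfSine_direction_bounds (L : ℝ × ℝ × ℝ →L[ℝ] ℝ) (S s : ℝ × ℝ × ℝ → ℝ) (u v p : ℝ × ℝ × ℝ)
    (hS : S = fun q => Real.sin (L q / 2)) (hs : s = fun q => fderiv ℝ S q u) (hu : |L u| ≤ 1) (hv : |L v| ≤ 1) :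
    DifferentiableAt ℝ S p ∧ DifferentiableAt ℝ s p ∧ |S p| ≤ 1 ∧ |fderiv ℝ S p v| ≤ 1 ∧ |s p| ≤ 1 ∧
      |fderiv ℝ s p v| ≤ 1 := by
  -- the inner affine map
  have hlin : ∀ q, HasFDerivAt (fun q : ℝ × ℝ × ℝ => L q / 2) ((1 / 2 : ℝ) • L) q := fun q => by
    have e : (fun q : ℝ × ℝ × ℝ => L q / 2) = fun q => ((1 / 2 : ℝ) • L) q := by
      funext r; simp only [FunLike.coe_smul, Pi.smul_apply, smul_eq_mul]; ring
    rw [e]; exact ((1 / 2 : ℝ) • L).hasFDerivAt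
  -- `S`
  have hSd : ∀ q, HasFDerivAt S (Real.cos (L q / 2) • ((1 / 2 : ℝ) • L)) q := fun q => by
    rw [hS]; exact (Real.hasDerivAt_sin _).comp_hasFDerivAt q (hlin q)
  have hSf : ∀ q w, fderiv ℝ S q w = Real.cos (L q / 2) / 2 * L w := fun q w => by
    rw [(hSd q).fderiv]; simp only [smul_apply, smul_eq_mul]; ring
  -- `s`
  have hsfun : s = fun q => L u / 2 * Real.cos (L q / 2) := by
    rw [hs]; funext q; rw [hSf]; ring
  have hsd : ∀ q, HasFDerivAt s ((L u / 2) • (-Real.sin (L q / 2) • ((1 / 2 : ℝ) • L))) q := fun q => by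
    rw [hsfun]; exact ((Real.hasDerivAt_cos _).comp_hasFDerivAt q (hlin q)).const_mul (L u / 2)
  have hsf : ∀ q w, fderiv ℝ s q w = -(L u * Real.sin (L q / 2) * L w) / 4 := fun q w => by
    rw [(hsd q).fderiv]; simp only [smul_apply, smul_eq_mul]; ring
  have hc1 := Real.abs_cos_le_one (L p / 2)
  have hs1 := Real.abs_sin_le_one (L p / 2)
  have n1 := abs_nonneg (L u)
  have n2 := abs_nonneg (L v)
  have n3 := abs_nonneg (Real.cos (L p / 2))
  have n4 := abs_nonneg (Real.sin (L p / 2))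
  refine ⟨(hSd p).differentiableAt, (hsd p).differentiableAt, ?_, ?_, ?_, ?_⟩
  · rw [hS]; exact Real.abs_sin_le_one _
  · rw [hSf, abs_mul, abs_div, abs_two]
    have := mul_le_mul hc1 hv n2 zero_le_one
    linarith
  · rw [hsfun]; simp only
    rw [abs_mul, abs_div, abs_two]
    have := mul_le_mul hu hc1 n3 zero_le_one
    linarith
  · rw [hsf, abs_div, abs_neg, abs_mul, abs_mul, show |(4 : ℝ)| = 4 by norm_num]
    have h1 := mul_le_mul hu hs1 n4 zero_le_one
    have h2 := mul_le_mul h1 hv n2 (by positivity)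
    linarith

/-! ### The concrete bounds -/

/-- `Ω` is `2π`-periodic under the three coordinate shifts (vector form). [folklore] -/
theorem resonance_Omega_shift (ω₂ : ℝ) :
    (∀ q : ℝ × ℝ × ℝ, resonanceFn ω₂ (q + (2 * Real.pi, 0, 0)).1 (q + (2 * Real.pi, 0, 0)).2.2
        (q + (2 * Real.pi, 0, 0)).2.1 = resonanceFn ω₂ q.1 q.2.2 q.2.1) ∧
    (∀ q : ℝ × ℝ × ℝ, resonanceFn ω₂ (q + (0, 2 * Real.pi, 0)).1 (q + (0, 2 * Real.pi, 0)).2.2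
        (q + (0, 2 * Real.pi, 0)).2.1 = resonanceFn ω₂ q.1 q.2.2 q.2.1) ∧
    (∀ q : ℝ × ℝ × ℝ, resonanceFn ω₂ (q + (0, 0, 2 * Real.pi)).1 (q + (0, 0, 2 * Real.pi)).2.2
        (q + (0, 0, 2 * Real.pi)).2.1 = resonanceFn ω₂ q.1 q.2.2 q.2.1) := by
  refine ⟨fun q => ?_, fun q => ?_, fun q => ?_⟩
  · have := resonanceFn_cell_periodic_fst ω₂ q
    simpa only [Prod.fst_add, Prod.snd_add, add_zero] using this
  · have := resonanceFn_cell_periodic_mid ω₂ q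
    simpa only [Prod.fst_add, Prod.snd_add, add_zero] using this
  · have := resonanceFn_cell_periodic_snd ω₂ q
    simpa only [Prod.fst_add, Prod.snd_add, add_zero] using this

/-- **Registered sub-goal `resonance_structure_bounds` of stub B1b″ (item (C2-Ω)).** For `ω₂ > 0`, `A, S₁, S₂` as
in `resonance_product_structure`, and any frame `e` with `|(e i)₃ − (e i)₁| ≤ 1`, `|(e i)₃ − (e i)₂| ≤ 1`
(`p = (k₁,(k₃,k₂))`; e.g. the standard basis): there are `Cₙ, C_t ≥ 0` with
`|∂_{e j}∂_{e k}Ω (p)| ≤ Cₙ(|A p| + |S₁ p| + |S₂ p|)` and `|∂_{e l}∂_{e j}∂_{e k}Ω (p)| ≤ C_t` for all `p k j l`.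
[folklore] -/
theorem resonance_structure_bounds :
    ∀ ω₂ : ℝ, 0 < ω₂ → ∀ (A S₁ S₂ : ℝ × ℝ × ℝ → ℝ),
      (∀ p : ℝ × ℝ × ℝ, S₁ p = Real.sin ((p.2.1 - p.1) / 2)) →
      (∀ p : ℝ × ℝ × ℝ, S₂ p = Real.sin ((p.2.1 - p.2.2) / 2)) →
      (∀ p : ℝ × ℝ × ℝ, A p =
        8 * ((dispersion ω₂ p.1 * dispersion ω₂ p.2.2 +
                dispersion ω₂ p.2.1 * dispersion ω₂ (p.1 + p.2.2 - p.2.1) + 2 * (ω₂ + 2)) *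
              Real.cos ((p.1 + p.2.2) / 2) -
            4 * Real.cos ((p.2.1 - p.1) / 2) * Real.cos ((p.2.2 - p.2.1) / 2)) /
          ((dispersion ω₂ p.1 + dispersion ω₂ p.2.2 + dispersion ω₂ p.2.1 + dispersion ω₂ (p.1 + p.2.2 - p.2.1)) *
            (dispersion ω₂ p.1 * dispersion ω₂ p.2.2 +
              dispersion ω₂ p.2.1 * dispersion ω₂ (p.1 + p.2.2 - p.2.1)))) →
      ∀ e : Fin 3 → ℝ × ℝ × ℝ, (∀ i, |(e i).2.1 - (e i).1| ≤ 1 ∧ |(e i).2.1 - (e i).2.2| ≤ 1) →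
      ∃ Cn Ct : ℝ, 0 ≤ Cn ∧ 0 ≤ Ct ∧ ∀ (p : ℝ × ℝ × ℝ) (k j l : Fin 3),
        |fderiv ℝ (fun q => fderiv ℝ (fun r : ℝ × ℝ × ℝ => resonanceFn ω₂ r.1 r.2.2 r.2.1) q (e k)) p (e j)| ≤
            Cn * (|A p| + |S₁ p| + |S₂ p|) ∧
        |fderiv ℝ (fun q => fderiv ℝ
            (fun r => fderiv ℝ (fun w : ℝ × ℝ × ℝ => resonanceFn ω₂ w.1 w.2.2 w.2.1) r (e k)) q (e j)) p (e l)| ≤ Ct := by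
  intro ω₂ hω A S₁ S₂ hS₁ hS₂ hA e he
  set Ω : ℝ × ℝ × ℝ → ℝ := fun q => resonanceFn ω₂ q.1 q.2.2 q.2.1 with hΩ
  -- uniform bounds on `A` along the frame
  obtain ⟨CA, hCA0, hCA⟩ := resonance_A_bounds hω hA e
  have hA2 : ContDiff ℝ 2 A := resonance_contDiff_A hω hA 2
  -- the two linear forms
  set L₁ : ℝ × ℝ × ℝ →L[ℝ] ℝ :=
    (ContinuousLinearMap.fst ℝ ℝ ℝ).comp (ContinuousLinearMap.snd ℝ ℝ (ℝ × ℝ)) - ContinuousLinearMap.fst ℝ ℝ (ℝ × ℝ)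
    with hL₁
  set L₂ : ℝ × ℝ × ℝ →L[ℝ] ℝ :=
    (ContinuousLinearMap.fst ℝ ℝ ℝ).comp (ContinuousLinearMap.snd ℝ ℝ (ℝ × ℝ)) -
      (ContinuousLinearMap.snd ℝ ℝ ℝ).comp (ContinuousLinearMap.snd ℝ ℝ (ℝ × ℝ)) with hL₂
  have hL₁a : ∀ q : ℝ × ℝ × ℝ, L₁ q = q.2.1 - q.1 := fun q => by simp [hL₁]
  have hL₂a : ∀ q : ℝ × ℝ × ℝ, L₂ q = q.2.1 - q.2.2 := fun q => by simp [hL₂]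
  have hS₁L : S₁ = fun q => Real.sin (L₁ q / 2) := funext fun q => by rw [hS₁, hL₁a]
  have hS₂L : S₂ = fun q => Real.sin (L₂ q / 2) := funext fun q => by rw [hS₂, hL₂a]
  -- `n`
  have hn : ∀ (p : ℝ × ℝ × ℝ) (k j : Fin 3),
      |fderiv ℝ (fun q => fderiv ℝ Ω q (e k)) p (e j)| ≤ 9 * (CA + 1) * (|A p| + |S₁ p| + |S₂ p|) := by
    intro p k j
    set a : ℝ × ℝ × ℝ → ℝ := fun q => fderiv ℝ A q (e k) with hadef
    set s₁ : ℝ × ℝ × ℝ → ℝ := fun q => fderiv ℝ S₁ q (e k) with hs₁def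
    set s₂ : ℝ × ℝ × ℝ → ℝ := fun q => fderiv ℝ S₂ q (e k) with hs₂def
    obtain ⟨dS₁, ds₁, bS₁, bS₁', bs₁, bs₁'⟩ := halfSine_direction_bounds L₁ S₁ s₁ (e k) (e j) p hS₁L hs₁def
      (by rw [hL₁a]; exact (he k).1) (by rw [hL₁a]; exact (he j).1)
    obtain ⟨dS₂, ds₂, bS₂, bS₂', bs₂, bs₂'⟩ := halfSine_direction_bounds L₂ S₂ s₂ (e k) (e j) p hS₂L hs₂def
      (by rw [hL₂a]; exact (he k).2) (by rw [hL₂a]; exact (he j).2)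
    have hAd : DifferentiableAt ℝ A p := (hA2.differentiable (by norm_num)) p
    have ha1 : ContDiff ℝ 1 a := (hA2.fderiv_right (m := 1) (by norm_num)).clm_apply contDiff_const
    have had : DifferentiableAt ℝ a p := (ha1.differentiable one_ne_zero) p
    have hd : (fun q => fderiv ℝ Ω q (e k)) = fun q => -(a q * S₁ q * S₂ q + A q * s₁ q * S₂ q + A q * S₁ q * s₂ q) := by
      funext q
      rw [hΩ, resonance_fderiv_Omega hω hS₁ hS₂ hA q (e k), hs₁def, hs₂def]
      simp only
      rw [resonance_fderiv_S₁ hS₁, resonance_fderiv_S₂ hS₂]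
    have hK : (1 : ℝ) ≤ CA + 1 := by linarith
    exact structure_fderiv_d_bound hK hAd dS₁ dS₂ had ds₁ ds₂ hd bS₁ bS₂ bs₁ bs₂ bS₁' bS₂' bs₁' bs₂'
      (((hCA p).2.1 k).trans (by linarith)) (((hCA p).2.2 k j).trans (by linarith)) (((hCA p).2.1 j).trans (by linarith))
  -- `t` by compactness
  have hΩ3 : ContDiff ℝ 3 Ω := resonance_contDiff_Omega hω 3
  obtain ⟨P1, P2, P3⟩ := resonance_Omega_shift ω₂
  have h2π : (0 : ℝ) < 2 * Real.pi := by positivity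
  have hf1 : ∀ k, ContDiff ℝ 2 fun r => fderiv ℝ Ω r (e k) := fun k =>
    (hΩ3.fderiv_right (m := 2) (by norm_num)).clm_apply contDiff_const
  have hf2 : ∀ k j, ContDiff ℝ 1 fun q => fderiv ℝ (fun r => fderiv ℝ Ω r (e k)) q (e j) := fun k j =>
    ((hf1 k).fderiv_right (m := 1) (by norm_num)).clm_apply contDiff_const
  have hg : ∀ k j l, Continuous fun p => fderiv ℝ (fun q => fderiv ℝ (fun r => fderiv ℝ Ω r (e k)) q (e j)) p (e l) :=
    fun k j l => ((hf2 k j).continuous_fderiv one_ne_zero).clm_apply continuous_const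
  -- periodicity chain
  have per0 : ∀ T : ℝ × ℝ × ℝ, (∀ q, Ω (q + T) = Ω q) → ∀ k j l q,
      fderiv ℝ (fun q => fderiv ℝ (fun r => fderiv ℝ Ω r (e k)) q (e j)) (q + T) (e l) =
        fderiv ℝ (fun q => fderiv ℝ (fun r => fderiv ℝ Ω r (e k)) q (e j)) q (e l) := by
    intro T hT k j l q
    have p1 : ∀ r, fderiv ℝ Ω (r + T) (e k) = fderiv ℝ Ω r (e k) := fun r => by rw [fderiv_periodic_vec hT r]
    have p2 : ∀ r, fderiv ℝ (fun r => fderiv ℝ Ω r (e k)) (r + T) (e j) = fderiv ℝ (fun r => fderiv ℝ Ω r (e k)) r (e j) :=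
      fun r => by rw [fderiv_periodic_vec (g := fun r => fderiv ℝ Ω r (e k)) p1 r]
    rw [fderiv_periodic_vec (g := fun q => fderiv ℝ (fun r => fderiv ℝ Ω r (e k)) q (e j)) p2 q]
  have ht : ∀ kjl : Fin 3 × Fin 3 × Fin 3, ∃ C : ℝ, ∀ p,
      |fderiv ℝ (fun q => fderiv ℝ (fun r => fderiv ℝ Ω r (e kjl.1)) q (e kjl.2.1)) p (e kjl.2.2)| ≤ C := fun kjl =>
    exists_bound_of_periodic3 (hg _ _ _) h2π (per0 _ P1 _ _ _) (per0 _ P2 _ _ _) (per0 _ P3 _ _ _)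
  obtain ⟨Ct, hCt0, hCt⟩ := exists_common_bound ht
  refine ⟨9 * (CA + 1), Ct, by positivity, hCt0, fun p k j l => ⟨hn p k j, ?_⟩⟩
  exact hCt (k, j, l) p

end Summit.AtomisticToContinuum.FouriersLaw.Theorems.DrudeDissolution.KineticPolymerGasOnTheTimeAxis

end
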